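import Literature.Computability.Complexity.YatesMachineSetup
import HarnessLib

/-!
# The evaluation machine of Williams' Lemma 4.2, II: the cube and the multiplicity table

Literature / circuit complexity, continuing `YatesMachineSetup.lean` (bank, parsing, mask words)
towards the machine `E` of Williams' evaluation lemma (Williams 2014, Lemma 4.2, Proof 2 /
App. C). After Phase 1 the tagged mask words `0 :: maskWord t` of the `s` terms sit on `M`; this
file builds the multiplicity table `f : T ↦ #{terms with variable set T}` (`fTable`,
`YatesTables.lean`) as a list of `2ⁿ` fixed-width words in the order of `T`, WITHOUT random
access: enumerate the cube, sort masks and cube points together, count runs.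

* **Phase 2** `enumProg` / `runs_enumProg` (`enumBody`, `enumRound`, `runs_enumLoop`): the
  tagged enumeration `enumWords n = [1 :: word_n T | T < 2ⁿ]` is built on `L` by `n` doubling
  rounds from `[[1]]` (`enumWords_succ`: append bit `0` to every word, then bit `1` to a copy),
  and a copy is kept on `Ek`; cost `enumCost n = O(n² 2ⁿ)`;
* the specification of the sort: **`radixIter_eq_flatMap_filter`** (LSD radix sort is the
  stable sort by the low bits: the sublists of equal key in increasing key order) and
  **`radixIter_sortIn`**: sorting `masks ++ enumeration` by the `n + 1` low bits yields
  `fCanon S` — for each `T` in increasing order, the masks equal to the word of `T` (as many as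
  `S.terms.count (finsetOfNat n T)`, `maskWord_eq_natToWord_iff`), then the enumeration word of
  `T` (keys `2T` and `2T + 1`);
* the counting pass: model `runStep`/`runFold` (on a mask increment the counter, on an
  enumeration word emit and reset it), **`runFold_fCanon`** (over `fCanon S` it emits
  `(fTable S).map (natToWord b)`), machine `runBody`/`runs_runPass`;
* **Phase 3** `fTableProg` / `runs_fTableProg`: masks in front of the enumeration, pass counter
  `W := 1^{n+1}` (`mkW`), the embedded radix sorter (`runs_sort`), the counting pass, the table
  poured back: `L := encList ((fTable S).map (natToWord b))`; cost `fTableCost n b s =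
  O((s + 2ⁿ) · n²  + 2ⁿ b)`.

## References

* R. Williams, *Nonuniform ACC circuit lower bounds*, J. ACM 61(1) (2014) 2:1–2:32, Lemma 4.2
  with Proof 2 and App. C (sorting-based table construction on tapes) [Williams2014].
* D. E. Knuth, *The Art of Computer Programming*, Vol. 3, 2nd ed., 1998, §5.2.5 (LSD radix
  sort and its stability).
-/

namespace Literature.Computability.Complexity

open SProg Com _root_.Computability Finset

namespace YatesM

open RRF YRF

/-! ### Specification: the enumeration of the cube by doubling -/

/-- The tagged enumeration words of width `j`: `1 :: (the j-bit word of T)`, `T < 2ʲ`, in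
increasing order of `T`. [folklore] -/
def enumWords (j : ℕ) : List (List Bool) := (List.range (2 ^ j)).map fun T => true :: natToWord j T

/-- One doubling step appends the next bit: first all words with bit `0`, then all with bit `1`.
[folklore] -/
theorem enumWords_succ (j : ℕ) :
    enumWords (j + 1) = (enumWords j).map (· ++ [false]) ++ (enumWords j).map (· ++ [true]) := by
  unfold enumWords
  rw [pow_succ, mul_two, List.range_add, List.map_append, List.map_map, List.map_map, List.map_map]
  congr 1
  · refine List.map_congr_left fun T hT => ?_
    rw [List.mem_range] at hT
    simp [natToWord_succ, Nat.testBit_lt_two_pow hT]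
  · refine List.map_congr_left fun T hT => ?_
    rw [List.mem_range] at hT
    simp only [Function.comp_apply, natToWord_succ, List.cons_append, List.cons.injEq, true_and]
    rw [Nat.testBit_two_pow_add_eq, Nat.testBit_lt_two_pow hT]
    simp only [Bool.not_false, List.append_cancel_right_eq]
    unfold natToWord
    congr 1; funext i
    rw [Nat.testBit_two_pow_add_gt i.2]

/-- `enumWords 0` is the single word `[1]`. [folklore] -/
theorem enumWords_zero : enumWords 0 = [[true]] := by simp [enumWords, natToWord]

/-- The enumeration words have length `j + 1`. [folklore] -/
theorem length_of_mem_enumWords {j : ℕ} {w : List Bool} (h : w ∈ enumWords j) : w.length = j + 1 := by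
  simp only [enumWords, List.mem_map] at h
  obtain ⟨T, -, rfl⟩ := h
  simp

/-- There are `2ʲ` enumeration words. [folklore] -/
@[simp] theorem length_enumWords (j : ℕ) : (enumWords j).length = 2 ^ j := by simp [enumWords]

/-! ### Specification: LSD radix sort is the stable sort by the low bits -/

/-- **Stability of LSD radix sort**: after `k` passes the list consists of the sublists of the
words with low bits `0, 1, …, 2ᵏ - 1`, in this order, each in the original order. [folklore] -/
theorem radixIter_eq_flatMap_filter (l : List (List Bool)) :
    ∀ k, radixIter l k = (List.range (2 ^ k)).flatMap fun v => l.filter fun w => decide (lowBits k w = v)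
  | 0 => by simp [radixIter, lowBits]
  | k + 1 => by
    rw [radixIter, radixIter_eq_flatMap_filter l k, radixPass, pow_succ, mul_two, List.range_add,
      List.flatMap_append]
    congr 1
    · rw [List.filter_flatMap]
      refine List.flatMap_congr fun v hv => ?_
      rw [List.mem_range] at hv
      rw [List.filter_filter]
      refine List.filter_congr fun w _ => ?_
      rw [lowBits_succ]
      cases hb : bitAt k w <;> simp
      omega
    · rw [List.filter_flatMap, List.flatMap_map]
      refine List.flatMap_congr fun v hv => ?_
      rw [List.mem_range] at hv
      rw [List.filter_filter]
      refine List.filter_congr fun w _ => ?_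
      rw [lowBits_succ]
      have := lowBits_lt k w
      cases hb : bitAt k w <;> simp <;> omega

/-- Regrouping a range of even length in pairs. [folklore] -/
theorem flatMap_range_two_mul {α : Type} (m : ℕ) (G : ℕ → List α) :
    (List.range (2 * m)).flatMap G = (List.range m).flatMap fun T => G (2 * T) ++ G (2 * T + 1) := by
  induction m with
  | zero => rfl
  | succ m ih =>
    rw [show 2 * (m + 1) = 2 * m + 1 + 1 by ring, List.range_succ, List.range_succ, List.flatMap_append,
      List.flatMap_append, ih, List.range_succ, List.flatMap_append]
    simp

/-! ### Specification: the sorted list of the multiplicity phase -/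

/-- The tagged mask word of a term. [folklore] -/
def tagMask {n : ℕ} (t : Finset (Fin n)) : List Bool := false :: maskWord t

/-- The list handed to the sorter: tagged masks, then the tagged enumeration. [folklore] -/
def sortIn {n : ℕ} (S : SymPlus n) : List (List Bool) := S.terms.map tagMask ++ enumWords n

/-- Its sorted form: for every `T < 2ⁿ`, the masks equal to the word of `T` (as many as there
are terms with variable set `finsetOfNat n T`), then the enumeration word of `T`. [folklore] -/
def fCanon {n : ℕ} (S : SymPlus n) : List (List Bool) :=
  (List.range (2 ^ n)).flatMap fun T =>
    List.replicate (S.terms.count (finsetOfNat n T)) (false :: natToWord n T) ++ [true :: natToWord n T]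

/-- A mask word is the word of `T` iff the term is the set of coordinates of `T`. [folklore] -/
theorem maskWord_eq_natToWord_iff {n : ℕ} (t : Finset (Fin n)) (T : ℕ) :
    maskWord t = natToWord n T ↔ t = finsetOfNat n T := by
  rw [maskWord, natToWord, List.ofFn_inj, funext_iff, Finset.ext_iff]
  refine forall_congr' fun i => ?_
  rw [mem_finsetOfNat]
  cases h : T.testBit i <;> simp

/-- The mask word has length `n`. [folklore] -/
@[simp] theorem length_maskWord {n : ℕ} (t : Finset (Fin n)) : (maskWord t).length = n := by
  simp [maskWord]

/-- **The sorter groups the masks with their enumeration word.** [folklore] -/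
theorem radixIter_sortIn {n : ℕ} (S : SymPlus n) : radixIter (sortIn S) (n + 1) = fCanon S := by
  rw [radixIter_eq_flatMap_filter, pow_succ', flatMap_range_two_mul, fCanon]
  refine List.flatMap_congr fun T hT => ?_
  rw [List.mem_range] at hT
  have hlow : ∀ w ∈ sortIn S, lowBits (n + 1) w = bitsToNat w := by
    intro w hw
    refine lowBits_of_length_le (le_of_eq ?_)
    simp only [sortIn, List.mem_append, List.mem_map] at hw
    rcases hw with ⟨t, -, rfl⟩ | hw
    · simp [tagMask]
    · exact length_of_mem_enumWords hw
  have hfilt : ∀ v, (sortIn S).filter (fun w => decide (lowBits (n + 1) w = v)) =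
      (sortIn S).filter (fun w => decide (bitsToNat w = v)) := fun v =>
    List.filter_congr fun w hw => by rw [hlow w hw]
  rw [hfilt, hfilt]
  simp only [sortIn, List.filter_append, List.filter_map]
  -- masks have even values, enumeration words odd values
  have hmaskval : ∀ t : Finset (Fin n), bitsToNat (tagMask t) = 2 * bitsToNat (maskWord t) := fun t => by
    simp [tagMask]
  have henumval : ∀ T' : ℕ, T' < 2 ^ n → bitsToNat (true :: natToWord n T') = 2 * T' + 1 := fun T' hT' => by
    rw [bitsToNat_cons, bitsToNat_natToWord_of_lt hT']; simp; ring
  have hmask_odd : S.terms.filter ((fun w => decide (bitsToNat w = 2 * T + 1)) ∘ tagMask) = [] := by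
    rw [List.filter_eq_nil_iff]; intro t _; simp [hmaskval]; omega
  have henum_even : (enumWords n).filter (fun w => decide (bitsToNat w = 2 * T)) = [] := by
    rw [List.filter_eq_nil_iff]; intro w hw
    simp only [enumWords, List.mem_map, List.mem_range] at hw
    obtain ⟨T', hT', rfl⟩ := hw
    simp [henumval T' hT']; omega
  have henum_odd : (enumWords n).filter (fun w => decide (bitsToNat w = 2 * T + 1)) = [true :: natToWord n T] := by
    rw [enumWords, List.filter_map]
    have : (List.range (2 ^ n)).filter ((fun w => decide (bitsToNat w = 2 * T + 1)) ∘ fun T' =>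
        true :: natToWord n T') = (List.range (2 ^ n)).filter (fun T' => decide (T' = T)) := by
      refine List.filter_congr fun T' hT' => ?_
      rw [List.mem_range] at hT'
      simp only [Function.comp_apply, henumval T' hT', decide_eq_decide]; omega
    rw [this, List.filter_eq, List.count_range, if_pos hT]
    rfl
  have hmask_even : (S.terms.filter ((fun w => decide (bitsToNat w = 2 * T)) ∘ tagMask)).map tagMask =
      List.replicate (S.terms.count (finsetOfNat n T)) (false :: natToWord n T) := by
    have hkey : ∀ t : Finset (Fin n), bitsToNat (maskWord t) = T ↔ t = finsetOfNat n T := by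
      intro t
      rw [← maskWord_eq_natToWord_iff]
      constructor
      · intro h
        have := natToWord_bitsToNat (maskWord t)
        rw [length_maskWord, h] at this
        exact this.symm
      · intro h; rw [h, bitsToNat_natToWord_of_lt hT]
    have : S.terms.filter ((fun w => decide (bitsToNat w = 2 * T)) ∘ tagMask) =
        S.terms.filter (fun t => decide (t = finsetOfNat n T)) := by
      refine List.filter_congr fun t _ => ?_
      simp only [Function.comp_apply, hmaskval, decide_eq_decide]
      rw [← hkey]; omega
    rw [this, List.filter_eq, List.map_replicate]
    congr 1
    rw [tagMask, (maskWord_eq_natToWord_iff _ T).2 rfl]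
  rw [hmask_odd, henum_even, henum_odd, hmask_even]
  simp


/-! ### Specification: the counting pass over the sorted list -/

/-- One step of the counting pass: an enumeration word (tag `1`) emits the counter and resets
it, a mask word (tag `0`) increments it. [folklore] -/
def runStep (b : ℕ) (st : List Bool × List (List Bool)) (w : List Bool) : List Bool × List (List Bool) :=
  match w with
  | true :: _ => (List.replicate b false, st.2 ++ [st.1])
  | false :: _ => (incrSpec st.1, st.2)
  | [] => st

/-- The counting pass as a fold. [folklore] -/
def runFold (b : ℕ) (l : List (List Bool)) (st : List Bool × List (List Bool)) :
    List Bool × List (List Bool) := l.foldl (runStep b) st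

/-- The zero word. [folklore] -/
theorem natToWord_zero (b : ℕ) : natToWord b 0 = List.replicate b false := by
  unfold natToWord
  refine List.ext_getElem (by simp) fun i h₁ h₂ => ?_
  simp

/-- Iterated increments count. [folklore] -/
theorem iterate_incrSpec_natToWord (b a : ℕ) : ∀ c, incrSpec^[c] (natToWord b a) = natToWord b (a + c)
  | 0 => rfl
  | c + 1 => by
    rw [Function.iterate_succ_apply', iterate_incrSpec_natToWord b a c, incrSpec_natToWord, Nat.add_assoc]

/-- The pass over one group: `c` mask words then the enumeration word emit the word of `c`.
[folklore] -/
theorem runFold_group (b c : ℕ) (w : List Bool) (l : List (List Bool)) (E : List (List Bool)) :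
    runFold b (List.replicate c (false :: w) ++ (true :: w) :: l) (List.replicate b false, E) =
      runFold b l (List.replicate b false, E ++ [natToWord b c]) := by
  unfold runFold
  rw [List.foldl_append, List.foldl_cons]
  have hrep : ∀ (c : ℕ) (acc : List Bool), List.foldl (runStep b) (acc, E) (List.replicate c (false :: w)) =
      (incrSpec^[c] acc, E) := by
    intro c
    induction c with
    | zero => intro acc; rfl
    | succ c ih =>
      intro acc
      rw [List.replicate_succ, List.foldl_cons, show runStep b (acc, E) (false :: w) = (incrSpec acc, E) from rfl,
        ih, ← Function.iterate_succ_apply]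
  rw [hrep, ← natToWord_zero, iterate_incrSpec_natToWord, Nat.zero_add]
  congr 1
  rw [natToWord_zero]; rfl

/-- **The counting pass over the sorted list yields the multiplicity table** (as `b`-bit words,
in the order of `T`), the counter ending at zero. [folklore] -/
theorem runFold_fCanon {n : ℕ} (S : SymPlus n) (b : ℕ) :
    runFold b (fCanon S) (List.replicate b false, []) =
      (List.replicate b false, (fTable S).map (natToWord b)) := by
  suffices H : ∀ (Ts : List ℕ) (E : List (List Bool)),
      runFold b (Ts.flatMap fun T => List.replicate (S.terms.count (finsetOfNat n T)) (false :: natToWord n T) ++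
        [true :: natToWord n T]) (List.replicate b false, E) =
        (List.replicate b false, E ++ Ts.map fun T => natToWord b (S.terms.count (finsetOfNat n T))) by
    have := H (List.range (2 ^ n)) []
    rw [List.nil_append] at this
    rw [fCanon, this, fTable, List.map_map]
    rfl
  intro Ts
  induction Ts with
  | nil => intro E; simp [runFold]
  | cons T Ts ih =>
    intro E
    rw [List.flatMap_cons, List.append_assoc, List.singleton_append]
    rw [show ∀ l, runFold b (List.replicate (S.terms.count (finsetOfNat n T)) (false :: natToWord n T) ++
        (true :: natToWord n T) :: l) (List.replicate b false, E) = _ from fun l => runFold_group b _ _ l E, ih]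
    simp

/-- Every word of the sorted list is a tag bit in front of an `n`-bit word. [folklore] -/
theorem exists_of_mem_fCanon {n : ℕ} (S : SymPlus n) {w : List Bool} (hw : w ∈ fCanon S) :
    ∃ (tg : Bool) (T : ℕ), w = tg :: natToWord n T := by
  simp only [fCanon, List.mem_flatMap, List.mem_range, List.mem_append, List.mem_replicate,
    List.mem_singleton] at hw
  obtain ⟨T, -, ⟨-, rfl⟩ | rfl⟩ := hw
  · exact ⟨false, T, rfl⟩
  · exact ⟨true, T, rfl⟩

/-- The sorted list has `s + 2ⁿ` words. [folklore] -/
theorem length_fCanon {n : ℕ} (S : SymPlus n) : (fCanon S).length = S.size + 2 ^ n := by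
  have h1 : (fCanon S).length = (sortIn S).length := by
    rw [← radixIter_sortIn, length_radixIter]
  rw [h1, sortIn, List.length_append, List.length_map, length_enumWords, SymPlus.size]

/-- The counter keeps its width along the pass. [folklore] -/
theorem length_runFold_fst (b : ℕ) : ∀ (l : List (List Bool)) (st : List Bool × List (List Bool)),
    st.1.length = b → (runFold b l st).1.length = b
  | [], st, h => h
  | w :: l, st, h => by
    rw [runFold, List.foldl_cons]
    refine length_runFold_fst b l _ ?_
    rcases w with _ | ⟨_ | _, _⟩ <;> simp [runStep, h]

/-! ### Phase 2: the enumeration of the cube -/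

/-- The body of a doubling round on one word `v`: copy it, emit `v·0` onto `z` and `v·1` onto
`o`. [folklore] -/
def enumBody : Com YReg :=
  readItemTo iL iA iw it ;; copy iA oC it ip ;;
    (emitPart iA iz ;; push iz false ;; push iz false ;; emitSep iz) ;;
    (emitPart oC io ;; push io true ;; push io true ;; emitSep io)

/-- Effect of `enumBody`: `29 |v| + 22` steps. [folklore] -/
theorem runs_enumBody (v rest : List Bool) (ρ : RRF) (σ : YRF) (hL : ρ.L = dbl v ++ false :: true :: rest)
    (hA : ρ.A = []) (hw : ρ.w = []) (ht : ρ.t = []) (hp : ρ.p = []) (hC : σ.C = []) :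
    Runs enumBody (est ρ σ) (est { ρ with
      L := rest
      z := true :: false :: ((dbl (v ++ [false])).reverse ++ ρ.z)
      o := true :: false :: ((dbl (v ++ [true])).reverse ++ ρ.o) } σ) (29 * v.length + 22) := by
  set ρ₁ : RRF := { ρ with L := rest, A := v } with hρ₁
  have h1 : Runs (readItemTo iL iA iw it) (est ρ σ) (est ρ₁ σ) (11 * v.length + 9) := by
    have h := runs_readItemTo (L := iL) (A := iA) (w := iw) (t := it) (by decide) (by decide) (by decide)
      (by decide) (by decide) v rest (est ρ σ) (by simp [hL]) (by simp [hw]) (by simp [ht])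
    refine h.of_eq ?_ le_rfl
    simp only [hρ₁]; simp [hA]
  set σ₂ : YRF := { σ with C := v } with hσ₂
  have h2 : Runs (copy iA oC it ip) (est ρ₁ σ) (est ρ₁ σ₂) (10 * v.length + 3) := by
    have h := runs_copy (a := iA) (b := oC) (t := it) (u := ip) (by decide) (by decide) (by decide)
      (by decide) (by decide) (by decide) (est ρ₁ σ) (by simp [hρ₁, ht]) (by simp [hρ₁, hp])
    refine h.of_eq ?_ (by simp [hρ₁])
    simp only [hσ₂, hρ₁]; simp [hC]
  set ρ₃ : RRF := { ρ₁ with A := [], z := true :: false :: ((dbl (v ++ [false])).reverse ++ ρ.z) } with hρ₃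
  have h3 : Runs (emitPart iA iz ;; push iz false ;; push iz false ;; emitSep iz) (est ρ₁ σ₂) (est ρ₃ σ₂)
      (4 * v.length + 1 + 1 + 1 + 2) := by
    have e1 := runs_emitPart (h := iA) (o := iz) (by decide) (est ρ₁ σ₂)
    have hl : (est ρ₁ σ₂ iA).length = v.length := by simp [hρ₁]
    rw [hl] at e1
    refine (e1.seq ((Runs.push iz false _).seq ((Runs.push iz false _).seq (runs_emitSep iz _)))).of_eq ?_ le_rfl
    simp only [hρ₃, hρ₁]; simp [dbl]
  set σ₄ : YRF := { σ₂ with C := [] } with hσ₄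
  set ρ₄ : RRF := { ρ₃ with o := true :: false :: ((dbl (v ++ [true])).reverse ++ ρ.o) } with hρ₄
  have h4 : Runs (emitPart oC io ;; push io true ;; push io true ;; emitSep io) (est ρ₃ σ₂) (est ρ₄ σ₄)
      (4 * v.length + 1 + 1 + 1 + 2) := by
    have e1 := runs_emitPart (h := oC) (o := io) (by decide) (est ρ₃ σ₂)
    have hl : (est ρ₃ σ₂ oC).length = v.length := by simp [hσ₂]
    rw [hl] at e1
    refine (e1.seq ((Runs.push io true _).seq ((Runs.push io true _).seq (runs_emitSep io _)))).of_eq ?_ le_rfl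
    simp only [hρ₄, hρ₃, hρ₁, hσ₄, hσ₂]; simp [dbl]
  have H := h1.seq (h2.seq (h3.seq h4))
  refine H.of_eq ?_ (by omega)
  simp only [hρ₄, hρ₃, hρ₁, hσ₄, hσ₂, hA]
  obtain ⟨⟩ := σ; simp only at hC ⊢; subst hC; rfl

/-- A doubling round: the body over all words, then the `1`-words under the `0`-words back on
`L`. [folklore] -/
def enumRound : Com YReg := streamLoop iL iw enumBody ;; pour io iL ;; pour iz iL

/-- The cost of a doubling round on the words `E`. [folklore] -/
def enumRoundCost (E : List (List Bool)) : ℕ := (E.map fun v => 41 * v.length + 52).sum + 6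

/-- **Effect of a doubling round**: `L := encList (E·0 ++ E·1)`. [folklore] -/
theorem runs_enumRound (E : List (List Bool)) (ρ : RRF) (σ : YRF) (hL : ρ.L = encList E) (hA : ρ.A = [])
    (hz : ρ.z = []) (ho : ρ.o = []) (hw : ρ.w = []) (ht : ρ.t = []) (hp : ρ.p = []) (hC : σ.C = []) :
    Runs enumRound (est ρ σ)
      (est { ρ with L := encList (E.map (· ++ [false]) ++ E.map (· ++ [true])) } σ) (enumRoundCost E) := by
  let P : List (List Bool) → Regs YReg → Prop := fun l R => ∃ done, E = done ++ l ∧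
    R = est { ρ with
      L := encList l
      z := outRev (done.map (· ++ [false]))
      o := outRev (done.map (· ++ [true])) } σ
  have hbody : ∀ (a : List Bool) (l : List (List Bool)) (R : Regs YReg), P (a :: l) R →
      R iL = encList (a :: l) → R iw = [] → ∃ R', Runs enumBody R R' (29 * a.length + 22) ∧
        R' iL = encList l ∧ R' iw = [] ∧ P l R' := by
    rintro a l R ⟨done, hdone, rfl⟩ - -
    refine ⟨_, runs_enumBody a (encList l) _ σ (by simp [encList_cons_eq_dbl]) (by simp [hA]) (by simp [hw])
      (by simp [ht]) (by simp [hp]) hC, by simp, by simp [hw], done ++ [a], by simp [hdone], ?_⟩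
    simp [outRev_append, dbl]
  obtain ⟨R', hloop, -, -, ⟨done, hdone, rfl⟩⟩ := runs_streamLoop (L := iL) (w := iw) (by decide) encList rfl
    encList_cons_ne_nil P (fun a => 29 * a.length + 22) hbody E (est ρ σ)
    ⟨[], by simp, by obtain ⟨⟩ := ρ; simp only at hL hz ho ⊢; simp [hL, hz, ho]⟩ (by simp [hL]) (by simp [hw])
  rw [List.append_nil] at hdone
  subst hdone
  set Z := E.map (· ++ [false]) with hZ
  set O := E.map (· ++ [true]) with hO
  have h2 := runs_pour (a := io) (b := iL) (by decide)
    (est { ρ with L := encList ([] : List (List Bool)), z := outRev Z, o := outRev O } σ)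
  have h3 := runs_pour (a := iz) (b := iL) (by decide) (est { ρ with L := encList O, z := outRev Z, o := [] } σ)
  simp only [Sum.elim_inl, regs_o, regs_L, update_est_inl, update_o, update_L, regs_z, update_z, encList_nil,
    reverse_outRev, List.append_nil] at h2 h3
  refine (hloop.seq (h2.seq h3)).of_eq ?_ ?_
  · rw [show encList Z ++ encList O = encList (Z ++ O) by
      rw [encList_eq_flatMap, encList_eq_flatMap, encList_eq_flatMap, List.flatMap_append]]
    obtain ⟨⟩ := ρ; simp only at hz ho ⊢; simp [hz, ho]
  · rw [Radix.length_outRev, Radix.length_outRev, enumRoundCost, hZ, hO]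
    simp only [List.map_map]
    have key : ∀ d : List (List Bool), (d.map fun a => 29 * a.length + 22).sum + 6 * d.length + 4 +
        (3 * (d.map ((fun v => 2 * v.length + 2) ∘ fun x => x ++ [true])).sum + 1 +
        (3 * (d.map ((fun v => 2 * v.length + 2) ∘ fun x => x ++ [false])).sum + 1)) ≤
        (d.map fun v => 41 * v.length + 52).sum + 6 := by
      intro d
      induction d with
      | nil => simp
      | cons a d ih =>
        simp only [List.map_cons, List.sum_cons, List.length_cons, Function.comp_apply, List.length_append,
          List.length_nil] at ih ⊢
        omega
    exact key E

/-- A uniform bound for a doubling round below width `n`. [folklore] -/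
def enumRoundBound (n : ℕ) : ℕ := 2 ^ n * (41 * n + 93) + 9

/-- The doubling rounds from width `j`, `k` more to go (counter `N`, tokens parked on `N2`).
[folklore] -/
theorem runs_enumLoop (n : ℕ) : ∀ (k j : ℕ) (ρ : RRF) (σ : YRF), j + k = n → ρ.L = encList (enumWords j) →
    ρ.A = [] → ρ.z = [] → ρ.o = [] → ρ.w = [] → ρ.t = [] → ρ.p = [] → σ.C = [] →
    σ.N = List.replicate k true → σ.N2 = List.replicate j true →
    Runs (countLoop oN (enumRound ;; push oN2 true)) (est ρ σ)
      (est { ρ with L := encList (enumWords n) } { σ with N := [], N2 := List.replicate n true })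
      (k * (enumRoundBound n + 3) + 1)
  | 0, j, ρ, σ, hjk, hL, hA, hz, ho, hw, ht, hp, hC, hN, hN2 => by
    rw [Nat.add_zero] at hjk; subst hjk
    refine (Runs.loop_nil _ _ (by simpa using hN)).of_eq ?_ (by simp)
    obtain ⟨⟩ := ρ; obtain ⟨⟩ := σ; simp only at hL hN hN2 ⊢; simp [hL, hN, hN2]
  | k + 1, j, ρ, σ, hjk, hL, hA, hz, ho, hw, ht, hp, hC, hN, hN2 => by
    have hk : est ρ σ oN = true :: List.replicate k true := by simp [hN, List.replicate_succ]
    set σ₀ : YRF := { σ with N := List.replicate k true } with hσ₀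
    have hb := runs_enumRound (enumWords j) ρ σ₀ hL hA hz ho hw ht hp (by simp [hσ₀, hC])
    rw [← enumWords_succ] at hb
    set ρ₁ : RRF := { ρ with L := encList (enumWords (j + 1)) } with hρ₁
    set σ₁ : YRF := { σ₀ with N2 := List.replicate (j + 1) true } with hσ₁
    have hpush : Runs (push oN2 true) (est ρ₁ σ₀) (est ρ₁ σ₁) 1 :=
      Runs.push' (by simp only [hσ₁, hσ₀]; simp [hN2, List.replicate_succ])
    have ih := runs_enumLoop n k (j + 1) ρ₁ σ₁ (by omega) (by simp [hρ₁]) hA hz ho hw ht hp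
      (by simp [hσ₁, hσ₀, hC]) (by simp [hσ₁, hσ₀]) (by simp [hσ₁])
    have hcost : enumRoundCost (enumWords j) ≤ enumRoundBound n := by
      unfold enumRoundCost enumRoundBound enumWords
      rw [List.map_map]
      have : ((List.range (2 ^ j)).map ((fun v => 41 * v.length + 52) ∘ fun T => true :: natToWord j T)).sum =
          2 ^ j * (41 * (j + 1) + 52) := by
        rw [show ((fun v : List Bool => 41 * v.length + 52) ∘ fun T => true :: natToWord j T) =
          fun _ => 41 * (j + 1) + 52 by funext T; simp]
        rw [List.map_const', List.sum_replicate, List.length_range, smul_eq_mul]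
      rw [this]
      have h2 : 2 ^ j ≤ 2 ^ n := Nat.pow_le_pow_right two_pos (by omega)
      have h3 : 41 * (j + 1) + 52 ≤ 41 * n + 93 := by omega
      have := Nat.mul_le_mul h2 h3
      omega
    have hbp : Runs (enumRound ;; push oN2 true) (Function.update (est ρ σ) oN (List.replicate k true))
        (est ρ₁ σ₁) (enumRoundBound n + 1) := by
      have := (hb.mono hcost).seq hpush
      simpa [hσ₀, hρ₁] using this
    refine (Runs.loop_true hk hbp ih).of_eq ?_ ?_
    · simp only [hρ₁, hσ₁, hσ₀]
    · rw [add_mul, one_mul]; omega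

/-- `enumProg`: build `encList [[1]]` on `L`, double `n` times (restoring `N`), keep a copy of
the enumeration on `Ek`. [folklore] -/
def enumProg : Com YReg :=
  (push iL true ;; push iL false ;; push iL true ;; push iL true) ;;
    countLoop oN (enumRound ;; push oN2 true) ;; pour oN2 oN ;; copy iL oEk it ip

/-- The cost of the enumeration phase. [folklore] -/
def enumCost (n : ℕ) : ℕ := 4 + (n * (enumRoundBound n + 3) + 1) + (3 * n + 1) + (10 * (2 ^ n * (2 * n + 4)) + 3)

/-- The code of the enumeration has length `2ⁿ (2n + 4)`. [folklore] -/
theorem length_encList_enumWords (n : ℕ) : (encList (enumWords n)).length = 2 ^ n * (2 * n + 4) := by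
  rw [length_encList, enumWords, List.map_map]
  rw [show ((fun a : List Bool => 2 * a.length + 2) ∘ fun T => true :: natToWord n T) = fun _ => 2 * n + 4 by
    funext T; simp; ring]
  rw [List.map_const', List.sum_replicate, List.length_range, smul_eq_mul]

/-- **Effect of the enumeration phase**: `L := encList (enumWords n)`, a copy on `Ek`, `N`
restored. [folklore] -/
theorem runs_enumProg (n : ℕ) (ρ : RRF) (σ : YRF) (hL : ρ.L = []) (hA : ρ.A = []) (hz : ρ.z = [])
    (ho : ρ.o = []) (hw : ρ.w = []) (ht : ρ.t = []) (hp : ρ.p = []) (hC : σ.C = [])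
    (hN : σ.N = List.replicate n true) (hN2 : σ.N2 = []) (hEk : σ.Ek = []) :
    Runs enumProg (est ρ σ)
      (est { ρ with L := encList (enumWords n) } { σ with Ek := encList (enumWords n) }) (enumCost n) := by
  set ρ₁ : RRF := { ρ with L := encList (enumWords 0) } with hρ₁
  have h1 : Runs (push iL true ;; push iL false ;; push iL true ;; push iL true) (est ρ σ) (est ρ₁ σ) 4 := by
    refine ((Runs.push iL true _).seq ((Runs.push iL false _).seq ((Runs.push iL true _).seq
      (Runs.push iL true _)))).of_eq ?_ (by rfl)
    simp only [hρ₁, enumWords_zero]; simp [hL, encList_cons_eq_dbl, dbl]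
  have h2 := runs_enumLoop n n 0 ρ₁ σ (by omega) (by simp [hρ₁]) hA hz ho hw ht hp hC hN (by simp [hN2])
  set ρ₂ : RRF := { ρ with L := encList (enumWords n) } with hρ₂
  set σ₃ : YRF := { σ with N := List.replicate n true, N2 := [] } with hσ₃
  have h3 : Runs (pour oN2 oN) (est ρ₂ { σ with N := [], N2 := List.replicate n true }) (est ρ₂ σ₃) (3 * n + 1) := by
    have h := runs_pour (a := oN2) (b := oN) (by decide) (est ρ₂ { σ with N := [], N2 := List.replicate n true })
    simp only [Sum.elim_inr, regs_N2, List.length_replicate] at h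
    refine h.of_eq ?_ le_rfl
    simp only [hσ₃]; simp
  set σ₄ : YRF := { σ₃ with Ek := encList (enumWords n) } with hσ₄
  have h4 : Runs (copy iL oEk it ip) (est ρ₂ σ₃) (est ρ₂ σ₄) (10 * (2 ^ n * (2 * n + 4)) + 3) := by
    have h := runs_copy (a := iL) (b := oEk) (t := it) (u := ip) (by decide) (by decide) (by decide) (by decide)
      (by decide) (by decide) (est ρ₂ σ₃) (by simp [hρ₂, ht]) (by simp [hρ₂, hp])
    rw [show (est ρ₂ σ₃ iL).length = 2 ^ n * (2 * n + 4) by simp [hρ₂, length_encList_enumWords]] at h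
    refine h.of_eq ?_ le_rfl
    simp only [hσ₄, hσ₃, hρ₂]; simp [hEk]
  have H := h1.seq ((h2.of_eq (by simp only [hρ₂]) le_rfl).seq (h3.seq h4))
  refine H.of_eq ?_ (by unfold enumCost; omega)
  simp only [hσ₄, hσ₃, hρ₂, hN, hN2]

/-! ### Phase 3: the multiplicity table by sorting and counting -/

/-- `copyCount U A V`: per token of `U`, one token on `A` and one on `V`. [folklore] -/
def copyCount (U A V : YReg) : Com YReg := countLoop U (push A true ;; push V true)

/-- Effect of `copyCount`: `A := 1ⁱ ++ A`, `V := 1ⁱ ++ V`, `U` emptied; `4 i + 1` steps. [folklore] -/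
theorem runs_copyCount {U A V : YReg} (hUA : U ≠ A) (hUV : U ≠ V) (hAV : A ≠ V) :
    ∀ (i : ℕ) (R : Regs YReg), R U = List.replicate i true →
      Runs (copyCount U A V) R (Function.update (Function.update (Function.update R U [])
        A (List.replicate i true ++ R A)) V (List.replicate i true ++ R V)) (4 * i + 1)
  | 0, R, hU => by
    refine (Runs.loop_nil _ _ hU).of_eq ?_ (by omega)
    ext j : 1; simp only [Function.update_apply]; split_ifs <;> simp_all
  | i + 1, R, hU => by
    have hk : R U = true :: List.replicate i true := by rw [hU, List.replicate_succ]
    set R₁ : Regs YReg := Function.update (Function.update (Function.update R U (List.replicate i true))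
      A (true :: R A)) V (true :: R V) with hR₁
    have hb : Runs (push A true ;; push V true) (Function.update R U (List.replicate i true)) R₁ 2 := by
      refine ((Runs.push A true _).seq (Runs.push V true _)).of_eq ?_ (by rfl)
      rw [hR₁]; ext j : 1; simp only [Function.update_apply]; split_ifs <;> simp_all
    have ih := runs_copyCount hUA hUV hAV i R₁
      (by rw [hR₁]; simp only [Function.update_apply]; split_ifs <;> simp_all)
    refine (Runs.loop_true hk hb ih).of_eq ?_ (by omega)
    rw [hR₁]
    clear hk hb ih hU
    ext j : 1; simp only [Function.update_apply]
    split_ifs <;> simp_all [List.replicate_succ']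

/-- `mkW`: the pass counter `W := 1^{n+1}` from `N` (restored). [folklore] -/
def mkW : Com YReg := copyCount oN iW oN2 ;; pour oN2 oN ;; push iW true

/-- Effect of `mkW`: `7 n + 3` steps. [folklore] -/
theorem runs_mkW (n : ℕ) (ρ : RRF) (σ : YRF) (hW : ρ.W = []) (hN : σ.N = List.replicate n true)
    (hN2 : σ.N2 = []) :
    Runs mkW (est ρ σ) (est { ρ with W := List.replicate (n + 1) true } σ) (7 * n + 3) := by
  have h1 := runs_copyCount (U := oN) (A := iW) (V := oN2) (by decide) (by decide) (by decide) n (est ρ σ)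
    (by simp [hN])
  set σ₁ : YRF := { σ with N := [], N2 := List.replicate n true } with hσ₁
  set ρ₁ : RRF := { ρ with W := List.replicate n true } with hρ₁
  have h1' : Runs (copyCount oN iW oN2) (est ρ σ) (est ρ₁ σ₁) (4 * n + 1) := by
    refine h1.of_eq ?_ le_rfl
    simp only [hσ₁, hρ₁]; simp [hW, hN2]
  have h2 : Runs (pour oN2 oN) (est ρ₁ σ₁) (est ρ₁ σ) (3 * n + 1) := by
    have h := runs_pour (a := oN2) (b := oN) (by decide) (est ρ₁ σ₁)
    rw [show (est ρ₁ σ₁ oN2).length = n by simp [hσ₁]] at h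
    refine h.of_eq ?_ le_rfl
    simp only [hσ₁]; obtain ⟨⟩ := σ; simp only at hN hN2 ⊢; simp [hN, hN2]
  have h3 : Runs (push iW true) (est ρ₁ σ) (est { ρ with W := List.replicate (n + 1) true } σ) 1 :=
    Runs.push' (by simp only [hρ₁]; simp [List.replicate_succ])
  exact (h1'.seq (h2.seq h3)).of_eq rfl (by omega)

/-- The body of the counting pass: read a word; on the tag `1` (enumeration word) emit the
counter onto `z` and reset it to `0ᵇ`; on the tag `0` (mask word) increment the counter.
[folklore] -/
def runBody : Com YReg :=
  readItemTo iL iA iw it ;;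
    pop iA (clear iA ;; emit oAcc iz ;; fillFalse oAcc oBw oN2 ;; pour oN2 oBw)
      (clear iA ;; incrWord oAcc oC iw) skip

/-- A uniform bound for the cost of `runBody`. [folklore] -/
def runBound (n b : ℕ) : ℕ := 13 * n + 11 * b + 31

/-- Effect of `runBody` on an enumeration word. [folklore] -/
theorem runs_runBody_true {n b : ℕ} (w rest : List Bool) (ρ : RRF) (σ : YRF)
    (hL : ρ.L = dbl (true :: w) ++ false :: true :: rest) (hw' : w.length = n) (hA : ρ.A = [])
    (hw : ρ.w = []) (ht : ρ.t = []) (hacc : σ.acc.length = b) (hBw : σ.Bw = List.replicate b true)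
    (hN2 : σ.N2 = []) :
    Runs runBody (est ρ σ) (est { ρ with L := rest, z := true :: false :: ((dbl σ.acc).reverse ++ ρ.z) }
      { σ with acc := List.replicate b false }) (runBound n b) := by
  set ρ₁ : RRF := { ρ with L := rest, A := true :: w } with hρ₁
  have h1 : Runs (readItemTo iL iA iw it) (est ρ σ) (est ρ₁ σ) (11 * (n + 1) + 9) := by
    have h := runs_readItemTo (L := iL) (A := iA) (w := iw) (t := it) (by decide) (by decide) (by decide)
      (by decide) (by decide) (true :: w) rest (est ρ σ) (by simp [hL]) (by simp [hw]) (by simp [ht])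
    refine h.of_eq ?_ (by simp [hw'])
    simp only [hρ₁]; simp [hA]
  set ρ₂ : RRF := { ρ₁ with A := [] } with hρ₂
  have h2 : Runs (clear iA) (Function.update (est ρ₁ σ) iA w) (est ρ₂ σ) (2 * n + 1) := by
    have h := runs_clear iA (Function.update (est ρ₁ σ) iA w)
    rw [show (Function.update (est ρ₁ σ) iA w iA).length = n by simp [hw']] at h
    refine h.of_eq ?_ le_rfl
    simp only [hρ₂, hρ₁]; simp
  set ρ₃ : RRF := { ρ₂ with z := true :: false :: ((dbl σ.acc).reverse ++ ρ.z) } with hρ₃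
  set σ₃ : YRF := { σ with acc := [] } with hσ₃
  have h3 : Runs (emit oAcc iz) (est ρ₂ σ) (est ρ₃ σ₃) (4 * b + 3) := by
    have h := runs_emit (h := oAcc) (o := iz) (by decide) (est ρ₂ σ)
    rw [show (est ρ₂ σ oAcc).length = b by simp [hacc]] at h
    refine h.of_eq ?_ le_rfl
    simp only [hρ₃, hρ₂, hρ₁, hσ₃]; simp [dbl]
  set σ₄ : YRF := { σ₃ with acc := List.replicate b false, Bw := [], N2 := List.replicate b true } with hσ₄
  have h4 : Runs (fillFalse oAcc oBw oN2) (est ρ₃ σ₃) (est ρ₃ σ₄) (4 * b + 1) := by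
    have h := runs_fillFalse (A := oAcc) (U := oBw) (V := oN2) (by decide) (by decide) (by decide) b
      (est ρ₃ σ₃) (by simp [hσ₃, hBw])
    refine h.of_eq ?_ le_rfl
    simp only [hσ₄, hσ₃]; simp [hN2]
  set σ₅ : YRF := { σ₄ with Bw := List.replicate b true, N2 := [] } with hσ₅
  have h5 : Runs (pour oN2 oBw) (est ρ₃ σ₄) (est ρ₃ σ₅) (3 * b + 1) := by
    have h := runs_pour (a := oN2) (b := oBw) (by decide) (est ρ₃ σ₄)
    rw [show (est ρ₃ σ₄ oN2).length = b by simp [hσ₄]] at h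
    refine h.of_eq ?_ le_rfl
    simp only [hσ₅, hσ₄]; simp
  have hbr : Runs (pop iA (clear iA ;; emit oAcc iz ;; fillFalse oAcc oBw oN2 ;; pour oN2 oBw)
      (clear iA ;; incrWord oAcc oC iw) skip) (est ρ₁ σ) (est ρ₃ σ₅)
      (2 * n + 1 + (4 * b + 3 + (4 * b + 1 + (3 * b + 1))) + 2) :=
    Runs.pop_true _ _ (by simp [hρ₁]) (h2.seq (h3.seq (h4.seq h5)))
  refine (h1.seq hbr).of_eq ?_ (by unfold runBound; omega)
  simp only [hσ₅, hσ₄, hσ₃, hρ₃, hρ₂, hρ₁, hA]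
  obtain ⟨⟩ := σ; simp only at hBw hN2 ⊢; simp [hBw, hN2]

/-- Effect of `runBody` on a mask word. [folklore] -/
theorem runs_runBody_false {n b : ℕ} (w rest : List Bool) (ρ : RRF) (σ : YRF)
    (hL : ρ.L = dbl (false :: w) ++ false :: true :: rest) (hw' : w.length = n) (hA : ρ.A = [])
    (hw : ρ.w = []) (ht : ρ.t = []) (hacc : σ.acc.length = b) (hC : σ.C = []) :
    Runs runBody (est ρ σ) (est { ρ with L := rest } { σ with acc := incrSpec σ.acc }) (runBound n b) := by
  set ρ₁ : RRF := { ρ with L := rest, A := false :: w } with hρ₁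
  have h1 : Runs (readItemTo iL iA iw it) (est ρ σ) (est ρ₁ σ) (11 * (n + 1) + 9) := by
    have h := runs_readItemTo (L := iL) (A := iA) (w := iw) (t := it) (by decide) (by decide) (by decide)
      (by decide) (by decide) (false :: w) rest (est ρ σ) (by simp [hL]) (by simp [hw]) (by simp [ht])
    refine h.of_eq ?_ (by simp [hw'])
    simp only [hρ₁]; simp [hA]
  set ρ₂ : RRF := { ρ₁ with A := [] } with hρ₂
  have h2 : Runs (clear iA) (Function.update (est ρ₁ σ) iA w) (est ρ₂ σ) (2 * n + 1) := by
    have h := runs_clear iA (Function.update (est ρ₁ σ) iA w)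
    rw [show (Function.update (est ρ₁ σ) iA w iA).length = n by simp [hw']] at h
    refine h.of_eq ?_ le_rfl
    simp only [hρ₂, hρ₁]; simp
  have h3 : Runs (incrWord oAcc oC iw) (est ρ₂ σ) (est ρ₂ { σ with acc := incrSpec σ.acc }) (9 * b + 8) := by
    have h := runs_incrWord (A := oAcc) (T := oC) (w := iw) (by decide) (by decide) (by decide) (est ρ₂ σ)
      (by simp [hC]) (by simp [hρ₂, hρ₁, hw])
    rw [show (est ρ₂ σ oAcc).length = b by simp [hacc]] at h
    refine h.of_eq ?_ le_rfl
    simp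
  have hbr : Runs (pop iA (clear iA ;; emit oAcc iz ;; fillFalse oAcc oBw oN2 ;; pour oN2 oBw)
      (clear iA ;; incrWord oAcc oC iw) skip) (est ρ₁ σ) (est ρ₂ { σ with acc := incrSpec σ.acc })
      (2 * n + 1 + (9 * b + 8) + 2) :=
    Runs.pop_false _ _ (by simp [hρ₁]) (h2.seq h3)
  refine (h1.seq hbr).of_eq ?_ (by unfold runBound; omega)
  simp only [hρ₂, hρ₁, hA]

/-- **The counting pass** over a list of tagged `n`-bit words: the emitted words and the final
counter are those of the model `runFold`. [folklore] -/
theorem runs_runPass {n b : ℕ} (full : List (List Bool))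
    (hform : ∀ w ∈ full, ∃ (tg : Bool) (T : ℕ), w = tg :: natToWord n T) (ρ : RRF) (σ : YRF)
    (hL : ρ.L = encList full) (hA : ρ.A = []) (hz : ρ.z = []) (hw : ρ.w = []) (ht : ρ.t = [])
    (hacc : σ.acc = List.replicate b false) (hBw : σ.Bw = List.replicate b true) (hN2 : σ.N2 = [])
    (hC : σ.C = []) :
    Runs (streamLoop iL iw runBody) (est ρ σ)
      (est { ρ with L := [], z := outRev (runFold b full (List.replicate b false, [])).2 }
        { σ with acc := (runFold b full (List.replicate b false, [])).1 })
      ((full.map fun _ => runBound n b).sum + 6 * full.length + 4) := by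
  set st₀ : List Bool × List (List Bool) := (List.replicate b false, []) with hst₀
  let P : List (List Bool) → Regs YReg → Prop := fun l R => ∃ done, full = done ++ l ∧
    R = est { ρ with L := encList l, z := outRev (runFold b done st₀).2 } { σ with acc := (runFold b done st₀).1 }
  have hbody : ∀ (a : List Bool) (l : List (List Bool)) (R : Regs YReg), P (a :: l) R →
      R iL = encList (a :: l) → R iw = [] → ∃ R', Runs runBody R R' (runBound n b) ∧
        R' iL = encList l ∧ R' iw = [] ∧ P l R' := by
    rintro a l R ⟨done, hdone, rfl⟩ - -
    obtain ⟨tg, T, rfl⟩ := hform a (by rw [hdone]; simp)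
    have hlen : (runFold b done st₀).1.length = b := length_runFold_fst b done st₀ (by simp [hst₀])
    have hstep : runFold b (done ++ [tg :: natToWord n T]) st₀ = runStep b (runFold b done st₀) (tg :: natToWord n T) := by
      simp [runFold, List.foldl_append]
    cases tg with
    | true =>
      refine ⟨_, runs_runBody_true (n := n) (b := b) (natToWord n T) (encList l) _ _ (by simp [encList_cons_eq_dbl])
        (by simp) (by simp [hA]) (by simp [hw]) (by simp [ht]) (by simp [hlen]) (by simp [hBw]) (by simp [hN2]),
        by simp, by simp [hw], done ++ [true :: natToWord n T], by simp [hdone], ?_⟩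
      rw [hstep]; simp [runStep, outRev_append, dbl]
    | false =>
      refine ⟨_, runs_runBody_false (n := n) (b := b) (natToWord n T) (encList l) _ _ (by simp [encList_cons_eq_dbl])
        (by simp) (by simp [hA]) (by simp [hw]) (by simp [ht]) (by simp [hlen]) (by simp [hC]),
        by simp, by simp [hw], done ++ [false :: natToWord n T], by simp [hdone], ?_⟩
      rw [hstep]; simp [runStep]
  obtain ⟨R', hloop, -, -, ⟨done, hdone, rfl⟩⟩ := runs_streamLoop (L := iL) (w := iw) (by decide) encList rfl
    encList_cons_ne_nil P (fun _ => runBound n b) hbody full (est ρ σ)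
    ⟨[], by simp, by obtain ⟨⟩ := ρ; obtain ⟨⟩ := σ; simp only at hL hz hacc ⊢; simp [hL, hz, hacc, runFold, hst₀]⟩
    (by simp [hL]) (by simp [hw])
  rw [List.append_nil] at hdone
  subst hdone
  exact hloop.of_eq (by simp) le_rfl

/-- The cost of a sorting pass over `sortIn S`. [folklore] -/
theorem passCost_sortIn {n : ℕ} (S : SymPlus n) :
    Radix.passCost (n + 1) (sortIn S) = (S.size + 2 ^ n) * (33 * n + 63) + 6 := by
  unfold Radix.passCost
  have hconst : ∀ v ∈ sortIn S, 21 * v.length + 12 * (n + 1) + 30 = 33 * n + 63 := by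
    intro v hv
    simp only [sortIn, List.mem_append, List.mem_map] at hv
    rcases hv with ⟨t, -, rfl⟩ | hv
    · simp [tagMask]; ring
    · rw [length_of_mem_enumWords hv]; ring
  rw [List.map_congr_left hconst, List.map_const', List.sum_replicate, smul_eq_mul]
  congr 1
  rw [sortIn, List.length_append, List.length_map, length_enumWords, SymPlus.size]

/-- `fTableProg`: put the masks in front of the enumeration, sort by the `n + 1` low bits, run
the counting pass, pour the emitted table back onto `L`. [folklore] -/
def fTableProg : Com YReg :=
  pour oM iL ;; mkW ;; Radix.sortProg.map Sum.inl ;; clear iU ;; (fillFalse oAcc oBw oN2 ;; pour oN2 oBw) ;;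
    streamLoop iL iw runBody ;; pour iz iL ;; clear oAcc

/-- The cost of the multiplicity phase. [folklore] -/
def fTableCost (n b s : ℕ) : ℕ :=
  (3 * (s * (2 * n + 4)) + 1) + (7 * n + 3) + ((n + 1) * ((s + 2 ^ n) * (33 * n + 63) + 6 + 3) + 1) +
    (2 * (n + 1) + 1) + (4 * b + 1 + (3 * b + 1)) + ((s + 2 ^ n) * runBound n b + 6 * (s + 2 ^ n) + 4) +
    (3 * (2 ^ n * (2 * b + 2)) + 1) + (2 * b + 1)

/-- **Effect of the multiplicity phase**: `L := encList` of the multiplicity table `fTable S` in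
`b`-bit words, the masks consumed, everything else restored. [folklore] -/
theorem runs_fTableProg {n : ℕ} (S : SymPlus n) (b : ℕ) (ρ : RRF) (σ : YRF)
    (hL : ρ.L = encList (enumWords n)) (hA : ρ.A = []) (hz : ρ.z = []) (ho : ρ.o = []) (hw : ρ.w = [])
    (ht : ρ.t = []) (hU : ρ.U = []) (hV : ρ.V = []) (hp : ρ.p = []) (hW : ρ.W = [])
    (hM : σ.M = outRev (S.terms.map tagMask)) (hN : σ.N = List.replicate n true) (hN2 : σ.N2 = [])
    (hacc : σ.acc = []) (hBw : σ.Bw = List.replicate b true) (hC : σ.C = []) :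
    Runs fTableProg (est ρ σ) (est { ρ with L := encList ((fTable S).map (natToWord b)) } { σ with M := [] })
      (fTableCost n b S.size) := by
  -- masks in front of the enumeration
  set ρ₁ : RRF := { ρ with L := encList (sortIn S) } with hρ₁
  set σ₁ : YRF := { σ with M := [] } with hσ₁
  have h1 : Runs (pour oM iL) (est ρ σ) (est ρ₁ σ₁) (3 * (S.size * (2 * n + 4)) + 1) := by
    have h := runs_pour (a := oM) (b := iL) (by decide) (est ρ σ)
    have hlen : (est ρ σ oM).length = S.size * (2 * n + 4) := by
      simp only [Sum.elim_inr, regs_M, hM, Radix.length_outRev, List.map_map]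
      rw [show ((fun v : List Bool => 2 * v.length + 2) ∘ tagMask) = fun _ => 2 * n + 4 by
        funext t; simp [tagMask]; ring]
      rw [List.map_const', List.sum_replicate, smul_eq_mul, SymPlus.size]
    rw [hlen] at h
    refine h.of_eq ?_ le_rfl
    simp only [hρ₁, hσ₁]
    simp [hM, hL, reverse_outRev, sortIn, show ∀ l₁ l₂ : List (List Bool), encList l₁ ++ encList l₂ =
      encList (l₁ ++ l₂) from fun l₁ l₂ => by
        rw [encList_eq_flatMap, encList_eq_flatMap, encList_eq_flatMap, List.flatMap_append]]
  -- pass counter, sort, clear the bit index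
  set ρ₂ : RRF := { ρ₁ with W := List.replicate (n + 1) true } with hρ₂
  have h2 : Runs mkW (est ρ₁ σ₁) (est ρ₂ σ₁) (7 * n + 3) := runs_mkW n ρ₁ σ₁ (by simp [hρ₁, hW])
    (by simp [hσ₁, hN]) (by simp [hσ₁, hN2])
  set ρ₃ : RRF := { ρ₂ with L := encList (fCanon S), U := List.replicate (n + 1) true, W := [] } with hρ₃
  have h3 : Runs (Radix.sortProg.map Sum.inl) (est ρ₂ σ₁) (est ρ₃ σ₁)
      ((n + 1) * ((S.size + 2 ^ n) * (33 * n + 63) + 6 + 3) + 1) := by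
    have h := runs_sort (n + 1) (sortIn S) ρ₂ σ₁ (by simp [hρ₂, hρ₁]) (by simp [hρ₂, hρ₁, hA])
      (by simp [hρ₂, hρ₁, hz]) (by simp [hρ₂, hρ₁, ho]) (by simp [hρ₂, hρ₁, hw]) (by simp [hρ₂, hρ₁, ht])
      (by simp [hρ₂, hρ₁, hU]) (by simp [hρ₂, hρ₁, hV]) (by simp [hρ₂, hρ₁, hp]) (by simp [hρ₂])
    rw [passCost_sortIn, radixIter_sortIn] at h
    refine h.of_eq ?_ le_rfl
    simp only [hρ₃]
  set ρ₄ : RRF := { ρ₃ with U := [] } with hρ₄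
  have h4 : Runs (clear iU) (est ρ₃ σ₁) (est ρ₄ σ₁) (2 * (n + 1) + 1) := by
    have h := runs_clear iU (est ρ₃ σ₁)
    rw [show (est ρ₃ σ₁ iU).length = n + 1 by simp [hρ₃]] at h
    refine h.of_eq ?_ le_rfl
    simp only [hρ₄]; simp
  -- the counter
  set σ₅ : YRF := { σ₁ with acc := List.replicate b false } with hσ₅
  have h5 : Runs (fillFalse oAcc oBw oN2 ;; pour oN2 oBw) (est ρ₄ σ₁) (est ρ₄ σ₅) (4 * b + 1 + (3 * b + 1)) := by
    have e1 := runs_fillFalse (A := oAcc) (U := oBw) (V := oN2) (by decide) (by decide) (by decide) b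
      (est ρ₄ σ₁) (by simp [hσ₁, hBw])
    set σ' : YRF := { σ₁ with acc := List.replicate b false, Bw := [], N2 := List.replicate b true } with hσ'
    have e1' : Runs (fillFalse oAcc oBw oN2) (est ρ₄ σ₁) (est ρ₄ σ') (4 * b + 1) := by
      refine e1.of_eq ?_ le_rfl
      simp only [hσ', hσ₁]; simp [hacc, hN2]
    have e2 := runs_pour (a := oN2) (b := oBw) (by decide) (est ρ₄ σ')
    rw [show (est ρ₄ σ' oN2).length = b by simp [hσ']] at e2
    refine (e1'.seq e2).of_eq ?_ le_rfl
    simp only [hσ₅, hσ', hσ₁]; simp [hN2, hBw]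
  -- the counting pass
  have h6 := runs_runPass (n := n) (b := b) (fCanon S) (fun w hw => exists_of_mem_fCanon S hw) ρ₄ σ₅
    (by simp [hρ₄, hρ₃]) (by simp [hρ₄, hρ₃, hρ₂, hρ₁, hA]) (by simp [hρ₄, hρ₃, hρ₂, hρ₁, hz])
    (by simp [hρ₄, hρ₃, hρ₂, hρ₁, hw]) (by simp [hρ₄, hρ₃, hρ₂, hρ₁, ht]) (by simp [hσ₅])
    (by simp [hσ₅, hσ₁, hBw]) (by simp [hσ₅, hσ₁, hN2]) (by simp [hσ₅, hσ₁, hC])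
  rw [runFold_fCanon, length_fCanon] at h6
  simp only [List.map_const', List.sum_replicate, smul_eq_mul, length_fCanon] at h6
  set ρ₆ : RRF := { ρ₄ with L := [], z := outRev ((fTable S).map (natToWord b)) } with hρ₆
  -- pour the table back, clear the counter
  set ρ₇ : RRF := { ρ₆ with L := encList ((fTable S).map (natToWord b)), z := [] } with hρ₇
  have h7 : Runs (pour iz iL) (est ρ₆ σ₅) (est ρ₇ σ₅) (3 * (2 ^ n * (2 * b + 2)) + 1) := by
    have h := runs_pour (a := iz) (b := iL) (by decide) (est ρ₆ σ₅)
    have hlen : (est ρ₆ σ₅ iz).length = 2 ^ n * (2 * b + 2) := by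
      simp only [Sum.elim_inl, regs_z, hρ₆, Radix.length_outRev, List.map_map]
      rw [show ((fun v : List Bool => 2 * v.length + 2) ∘ natToWord b) = fun _ => 2 * b + 2 by funext v; simp]
      rw [List.map_const', List.sum_replicate, smul_eq_mul, length_fTable]
    rw [hlen] at h
    refine h.of_eq ?_ le_rfl
    simp only [hρ₇, hρ₆]; simp [reverse_outRev]
  have h8 : Runs (clear oAcc) (est ρ₇ σ₅) (est ρ₇ σ₁) (2 * b + 1) := by
    have h := runs_clear oAcc (est ρ₇ σ₅)
    rw [show (est ρ₇ σ₅ oAcc).length = b by simp [hσ₅]] at h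
    refine h.of_eq ?_ le_rfl
    simp only [hσ₅, hσ₁]; obtain ⟨⟩ := σ; simp only at hacc ⊢; simp [hacc]
  have h6' : Runs (streamLoop iL iw runBody) (est ρ₄ σ₅) (est ρ₆ σ₅)
      ((S.size + 2 ^ n) * runBound n b + 6 * (S.size + 2 ^ n) + 4) := by
    refine h6.of_eq ?_ le_rfl
    simp only [hρ₆, hσ₅, hσ₁]
  have H := h1.seq (h2.seq (h3.seq (h4.seq (h5.seq (h6'.seq (h7.seq h8))))))
  refine H.of_eq ?_ ?_
  · simp only [hρ₇, hρ₆, hρ₄, hρ₃, hρ₂, hρ₁, hσ₁, hU, hW, hz]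
  · unfold fTableCost; omega

end YatesM

end Literature.Computability.Complexity
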